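import Summits.BirchSwinnertonDyer.BirchSwinnertonDyer.Theorems.GenusKolyvaginAtTwoPowDvdShaCardAtTwoRTDeepOwnPrimeCondition
import Summits.BirchSwinnertonDyer.BirchSwinnertonDyer.Theorems.GenusKolyvaginAtTwoPowDvdShaCardAtTwoRTTransverseIsotropicInv
import HarnessLib

/-!
# Route `CMKolyvaginAtInertTwo`, crux `CMKolyvaginExactAtInertTwo` (stmt-BirchSwinnertonDyer-24277), `stub_lower` — W-UP on H₂,
# FILE W1: THE LOCAL CONDITION AT A DEEP OWN PRIME AT LEVEL `2`, as an ∃-theorem — `∃ M ≤ H¹(ℚ_ℓ, E[2])` with `2 ≤ #M`, killing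
# `⟨loc_ℓ Z, ·⟩` for every global `Z` TRANSVERSE at `ℓ`, and containing-in-its-annihilator every such `loc_ℓ Z`

Seat `bsd-line-cmk2-p1` g19 (cell `bsd-print-cf2`), `--supports stmt-BirchSwinnertonDyer-24277` (helper; closes nothing).
THEOREMS ONLY (no definition, no named fact, no `sorry`).  BSD is NOT proved by any of this; the crux is not closed here.

WHY.  The residual of `stub_lower` after files A–D1 is gk2's stub W-UP on H₂: a SHALLOW certificate (`P(n) ∉ 2E(K[n])`, own primes of
index `≥ 1`) must be upgraded to a level-`4` Gross witness.  On H₂ every certificate prime is a GROSS prime at level `2`, so the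
upgrade is McCallum's prime swap run at LEVEL `2` over `ℚ` (gk2 LEAD g16 memo `Lines/plus-descent-lead-g16.md` §3, gk2-p5
`Lines/plus-descent-wup2-gk2p5.md` §6): pair `Z = desc c₁(nℓ′) ∈ H¹(ℚ, E[2])` against an auxiliary `y` that is FREE at the shallow
own primes, ZERO at the genus places, Kummer elsewhere, and — at the DEEP own primes `t` of the witness, where `Z` is transverse — lies
in a local condition orthogonal to the transverse classes.  This file supplies that local condition at level `2`, by gk2-p4 g18's
annihilator trick (`…RTDeepOwnPrimeCondition`, level `4`, `X = loc(𝒯) ⊓ 2•H¹`) with the doubling REMOVED: at a place `v` with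
`#H¹(ℚ_v, E[2]) = 4` take `M := X^⊥`, `X := loc_v(𝒯)` the localisations of the global classes transverse at `v` (in gk2-p3's
`∀ 𝔓 ∀ F ∀ c₀` form); `X` is ISOTROPIC (gk2-p3 I7 `invWeilPairing_localization_eq_zero_of_transverse_of_Δ_neg`, valid at level `2^M`,
`M ≥ 1`), hence `#X ≤ 2` and `#M ≥ 2`; `⟨loc Z, m⟩ = 0` for `Z ∈ 𝒯`, `m ∈ M` by definition, and `loc Z ∈ {}^⊥M` likewise.
* §1 `exists_localCondition_two_le_of_isotropic` (any number field, level `2`, abstract isotropic subgroup `X` of the local `H¹`).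
* §2 `exists_localCondition_two_le_rat` (over `ℚ`, `Δ < 0`, a Gross–Kolyvagin prime `ℓ ≠ 2` of good reduction with `Frob_ℓ = Frob_∞` on
  `E[2]` and index `≥ 1`: `#H¹(ℚ_ℓ, E[2]) = 4` by LEAD's `natCard_galoisCohomology_one_toLocal_two_pow_eq`, isotropy by gk2-p3).

References: [McCallumLMS1991] §2 Prop. 2.1, §3 (3), §5 Lemma 5.3 and proof of Prop. 5.2; [GrossLMS1991] §7 (7.1), Prop. 9.6;
[MilneADT2006] Ch. I Cor. 2.3, Thm. 2.8.
-/

set_option autoImplicit false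
-- the Theorems namespace of this sub repeats the summit name by design (D-0017 nested layout)
set_option linter.dupNamespace false

noncomputable section

open scoped Classical

open CategoryTheory Field NumberField IsDedekindDomain Function
open _root_.WeierstrassCurve
open Literature.NumberTheory.EllipticCurves
open Literature.NumberTheory.GaloisRepresentations
open Literature.NumberTheory.GaloisCohomology
open Summit.BirchSwinnertonDyer.Rank1Residual.X11b.KummerPT
open Summit.BirchSwinnertonDyer.Rank1Residual.X11b.FiniteDuality
open Summit.BirchSwinnertonDyer.Rank1Residual.X11b.Relaxation
open scoped ContRepresentation

namespace Summit.BirchSwinnertonDyer.BirchSwinnertonDyer.Theorems.KolyvaginLowerTwo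

open Summit.BirchSwinnertonDyer.BirchSwinnertonDyer.Theorems.GenusExact
open Summit.BirchSwinnertonDyer.BirchSwinnertonDyer.Theorems.GenusExact.FrobeniusCriterion
open Summit.BirchSwinnertonDyer.BirchSwinnertonDyer.Theorems.GenusExact.RelaxedCount
open Summit.BirchSwinnertonDyer.BirchSwinnertonDyer.Theorems.GenusExact.DeepOwnPrime

/-! ## §1 Level `2`: the local condition of order `≥ 2` as the annihilator of an isotropic subgroup -/

section LevelTwo

variable {K : Type} [Field K] [NumberField K] (W : WeierstrassCurve K) [W.IsElliptic] (v : HeightOneSpectrum (𝓞 K))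
variable (e : geomTorsion W ((2 ^ 1 : ℕ) : ℤ) → geomTorsion W ((2 ^ 1 : ℕ) : ℤ) → AlgebraicClosure K)
  (hμ : ∀ S T, e S T ^ (2 ^ 1) = 1)
  (hadd₁ : ∀ S₁ S₂ T, e (S₁ + S₂) T = e S₁ T * e S₂ T)
  (hadd₂ : ∀ S T₁ T₂, e S (T₁ + T₂) = e S T₁ * e S T₂)
  (hgal : ∀ (σ : absoluteGaloisGroup K) (S T : geomTorsion W ((2 ^ 1 : ℕ) : ℤ)), σ • e S T = e (σ • S) (σ • T))
  (hnondeg : ∀ T, (∀ S, e S T = 1) → T = 0)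
  (inv : LocalInvariants K (2 ^ 1))

include hnondeg in
/-- **The local condition of order `≥ 2` at level `2`, abstract form.**  `v` a finite place with `#H¹(K_v, E[2]) = 4` and `inv_v`
injective; `X ≤ H¹(K_v, E[2])` an ISOTROPIC subgroup for `inv_v(· ∪ₑ ·)`.  Then `#X ≤ 2` and **`M := X^⊥` has `2 ≤ #M`**, kills
`⟨x, ·⟩` for `x ∈ X`, and `X ≤ {}^⊥M`.  (gk2-p4's `exists_localCondition_eight_le_of_frobenius` at level `2`, doubling removed.)
[cite: MilneADT2006, Ch. I, Cor. 2.3] [cite: McCallumLMS1991, §5 Lemma 5.3] -/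
theorem exists_localCondition_two_le_of_isotropic (hinv : Injective (inv (Sum.inr v)))
    (hV : Nat.card (galoisCohomology ((W.torsionGaloisModule ((2 ^ 1 : ℕ) : ℤ)).toLocal (Sum.inr v)) 1) = 4)
    (X : AddSubgroup (galoisCohomology ((W.torsionGaloisModule ((2 ^ 1 : ℕ) : ℤ)).toLocal (Sum.inr v)) 1))
    (hX : ∀ x ∈ X, ∀ x' ∈ X, invWeilPairing W (2 ^ 1) e hμ hadd₁ hadd₂ hgal inv (Sum.inr v) x x' = 0) :
    ∃ M : AddSubgroup (galoisCohomology ((W.torsionGaloisModule ((2 ^ 1 : ℕ) : ℤ)).toLocal (Sum.inr v)) 1),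
      2 ≤ Nat.card M ∧
      (∀ x ∈ X, ∀ m ∈ M, invWeilPairing W (2 ^ 1) e hμ hadd₁ hadd₂ hgal inv (Sum.inr v) x m = 0) ∧
      (∀ x ∈ X, x ∈ annLeft (invWeilPairing W (2 ^ 1) e hμ hadd₁ hadd₂ hgal inv (Sum.inr v)) M) := by
  classical
  haveI : CharZero (v.adicCompletion K) := charZero_adicCompletion v
  haveI : Fact (Nat.Prime 2) := ⟨Nat.prime_two⟩
  haveI hfin := finite_galoisCohomology_toLocal_inr W (2 ^ 1) v
  set V := galoisCohomology ((W.torsionGaloisModule ((2 ^ 1 : ℕ) : ℤ)).toLocal (Sum.inr v)) 1 with hVdef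
  set b := invWeilPairing W (2 ^ 1) e hμ hadd₁ hadd₂ hgal inv (Sum.inr v) with hb
  have hA : ∀ x : V, (2 ^ 1) • x = 0 := nsmul_galoisCohomology_toLocal_eq_zero W (2 ^ 1) (Sum.inr v)
  have hbij : Bijective b := invWeilPairing_bijective W (2 ^ 1) e hμ hadd₁ hadd₂ hgal hnondeg inv v hinv
  have hflip : Bijective b.flip := invWeilPairing_flip_bijective W (2 ^ 1) e hμ hadd₁ hadd₂ hgal hnondeg inv v hinv
  -- `X` isotropic ⟹ `#X ≤ 2`
  have hXle : X ≤ annLeft b X := fun x hx x' hx' ↦ hX x hx x' hx'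
  have hX2 : Nat.card X ≤ 2 := by
    have hmul := natCard_annLeft_mul hA b hbij X
    have hle : Nat.card X ≤ Nat.card (annLeft b X) := AddSubgroup.card_le_of_le hXle
    rw [hV] at hmul
    have hsq : Nat.card X * Nat.card X ≤ 4 := by
      calc Nat.card X * Nat.card X ≤ Nat.card (annLeft b X) * Nat.card X := Nat.mul_le_mul_right _ hle
        _ = 4 := hmul
    by_contra hlt
    push Not at hlt
    have h9 : 3 * 3 ≤ Nat.card X * Nat.card X := Nat.mul_le_mul hlt hlt
    omega
  -- `M := X^⊥`, `#M · #X = 4`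
  refine ⟨annRight b X, ?_, fun x hx m hm ↦ (mem_annRight_iff b X m).mp hm x hx, fun x hx ↦ ?_⟩
  · have hmul := natCard_annRight_mul hA b hflip X
    rw [hV] at hmul
    by_contra hlt
    push Not at hlt
    have h1 : Nat.card (annRight b X) * Nat.card X ≤ 1 * 2 := Nat.mul_le_mul (by omega) hX2
    have h2 : Nat.card (annRight b X) * Nat.card X = 4 := hmul
    rw [h2] at h1
    norm_num at h1
  · rw [mem_annLeft_iff]
    exact fun m hm ↦ (mem_annRight_iff b X m).mp hm x hx

end LevelTwo

/-! ## §2 Over `ℚ` at a Gross–Kolyvagin prime (the DEEP own primes of the level-`2` engine) -/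

section Rat

variable (W : WeierstrassCurve ℚ) [W.IsElliptic] [W.IsGloballyMinimal]
variable (e : geomTorsion W ((2 ^ 1 : ℕ) : ℤ) → geomTorsion W ((2 ^ 1 : ℕ) : ℤ) → AlgebraicClosure ℚ)
  (hμ : ∀ S T, e S T ^ (2 ^ 1) = 1)
  (hadd₁ : ∀ S₁ S₂ T, e (S₁ + S₂) T = e S₁ T * e S₂ T)
  (hadd₂ : ∀ S T₁ T₂, e S (T₁ + T₂) = e S T₁ * e S T₂)
  (hgal : ∀ (σ : absoluteGaloisGroup ℚ) (S T : geomTorsion W ((2 ^ 1 : ℕ) : ℤ)), σ • e S T = e (σ • S) (σ • T))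
  (halt : ∀ T, e T T = 1) (hnondeg : ∀ T, (∀ S, e S T = 1) → T = 0)
  (inv : LocalInvariants ℚ (2 ^ 1))

include halt hnondeg in
/-- **The local condition at a deep own prime over `ℚ` at LEVEL `2`.**  `E/ℚ` with `Δ < 0`; `ℓ ≠ 2` a prime of good reduction with
`Frob_ℓ = Frob_∞` on `E[2]` (`FrobEqFrobInfty W K 2 ℓ`, `K` any field of definition of the condition) and `kolyvaginIndex ≥ 1`
(so `#H¹(ℚ_ℓ, E[2]) = 4`); `v` its place, `inv_v` injective.  Then **`∃ M ≤ H¹(ℚ_ℓ, E[2])` with `2 ≤ #M`** such that for EVERY global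
`Z ∈ H¹(ℚ, E[2])` TRANSVERSE at `ℓ` (gk2-p3's form: over every prime `𝔓 ∣ v`, every arithmetic Frobenius `F` there and every complex
conjugation `c₀` with `F = c₀` on `E[2]`, `[Z, F] ∈ (F − 1)E[2]`): `inv_ℓ(loc_ℓ Z ∪ₑ m) = 0` for all `m ∈ M`, and `loc_ℓ Z ∈ {}^⊥M`.
Proof: §1 with `X := loc(𝒯)`, isotropic by gk2-p3's `invWeilPairing_localization_eq_zero_of_transverse_of_Δ_neg` (`M = 1`).
[cite: McCallumLMS1991, §5 Lemma 5.3 and proof of Prop. 5.2] [cite: GrossLMS1991, §3 (3.2), Prop. 9.6] [cite: MilneADT2006, Ch. I, Cor. 2.3] -/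
theorem exists_localCondition_two_le_rat (hΔ : W.Δ < 0) {K : Type} [Field K] [NumberField K]
    {ℓ : ℕ} [Fact ℓ.Prime] (hℓ2 : ℓ ≠ 2) (hgoodℓ : W.HasGoodReductionAtPrime ℓ) (hℓ : FrobEqFrobInfty W K 2 ℓ)
    {v : HeightOneSpectrum (𝓞 ℚ)} (hv : (ℓ : 𝓞 ℚ) ∈ v.asIdeal) (hidx : 1 ≤ Zhang2014.kolyvaginIndex W 2 ℓ)
    (hinv : Injective (inv (Sum.inr v))) :
    ∃ M : AddSubgroup (galoisCohomology ((W.torsionGaloisModule ((2 ^ 1 : ℕ) : ℤ)).toLocal (Sum.inr v)) 1),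
      2 ≤ Nat.card M ∧
      (∀ Z : galoisCohomology (W.torsionGaloisModule ((2 ^ 1 : ℕ) : ℤ)) 1,
        (∀ 𝔓 ∈ v.primesAbove, ∀ F c₀ : absoluteGaloisGroup ℚ, IsArithFrobAt (𝓞 ℚ) F 𝔓 →
          IsComplexConjugation (Rat.castHom ℝ) c₀ → (∀ P : geomTorsion W ((2 ^ 1 : ℕ) : ℤ), F • P = c₀ • P) →
          ∃ P₁ : geomTorsion W ((2 ^ 1 : ℕ) : ℤ), h1Eval W _ Z F = F • P₁ - P₁) →
        (∀ m ∈ M, invWeilPairing W (2 ^ 1) e hμ hadd₁ hadd₂ hgal inv (Sum.inr v)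
          (galoisCohomology.localization (W.torsionGaloisModule ((2 ^ 1 : ℕ) : ℤ)) (Sum.inr v) 1 Z) m = 0) ∧
        galoisCohomology.localization (W.torsionGaloisModule ((2 ^ 1 : ℕ) : ℤ)) (Sum.inr v) 1 Z ∈
          annLeft (invWeilPairing W (2 ^ 1) e hμ hadd₁ hadd₂ hgal inv (Sum.inr v)) M) := by
  classical
  have hℓp : ℓ.Prime := Fact.out
  have hgood : W.HasGoodReductionAt v := W.hasGoodReductionAt_of_hasGoodReductionAtPrime v hv hgoodℓ
  have hV : Nat.card (galoisCohomology ((W.torsionGaloisModule ((2 ^ 1 : ℕ) : ℤ)).toLocal (Sum.inr v)) 1) = 4 := by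
    rw [natCard_galoisCohomology_one_toLocal_two_pow_eq W hΔ hℓ2 hgoodℓ hℓ hv one_ne_zero hidx]; norm_num
  set loc := galoisCohomology.localization (W.torsionGaloisModule ((2 ^ 1 : ℕ) : ℤ)) (Sum.inr v) 1 with hloc
  -- the subgroup of classes transverse at `v` (gk2-p3's `∀ 𝔓 ∀ F ∀ c₀` form)
  let 𝒯 : AddSubgroup (galH1Torsion W ((2 ^ 1 : ℕ) : ℤ)) :=
    { carrier := {x | ∀ 𝔓 ∈ v.primesAbove, ∀ F c₀ : absoluteGaloisGroup ℚ, IsArithFrobAt (𝓞 ℚ) F 𝔓 →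
        IsComplexConjugation (Rat.castHom ℝ) c₀ → (∀ P : geomTorsion W ((2 ^ 1 : ℕ) : ℤ), F • P = c₀ • P) →
        ∃ P₁ : geomTorsion W ((2 ^ 1 : ℕ) : ℤ), h1Eval W _ x F = F • P₁ - P₁}
      add_mem' := fun hx hy 𝔓 h𝔓 F c₀ hF hc₀ hE ↦ transverse_add W _ (hx 𝔓 h𝔓 F c₀ hF hc₀ hE) (hy 𝔓 h𝔓 F c₀ hF hc₀ hE)
      zero_mem' := fun 𝔓 _ F _ _ _ _ ↦ transverse_zero W _ F
      neg_mem' := fun hx 𝔓 h𝔓 F c₀ hF hc₀ hE ↦ transverse_neg W _ (hx 𝔓 h𝔓 F c₀ hF hc₀ hE) }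
  have h𝒯 : ∀ x, x ∈ 𝒯 ↔ ∀ 𝔓 ∈ v.primesAbove, ∀ F c₀ : absoluteGaloisGroup ℚ, IsArithFrobAt (𝓞 ℚ) F 𝔓 →
      IsComplexConjugation (Rat.castHom ℝ) c₀ → (∀ P : geomTorsion W ((2 ^ 1 : ℕ) : ℤ), F • P = c₀ • P) →
      ∃ P₁ : geomTorsion W ((2 ^ 1 : ℕ) : ℤ), h1Eval W _ x F = F • P₁ - P₁ := fun x ↦ Iff.rfl
  set X : AddSubgroup (galoisCohomology ((W.torsionGaloisModule ((2 ^ 1 : ℕ) : ℤ)).toLocal (Sum.inr v)) 1) := 𝒯.map loc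
    with hXdef
  -- `X` is isotropic (gk2-p3's I7 at level `2`)
  have hXiso : ∀ x ∈ X, ∀ x' ∈ X, invWeilPairing W (2 ^ 1) e hμ hadd₁ hadd₂ hgal inv (Sum.inr v) x x' = 0 := by
    rintro _ ⟨z, hz, rfl⟩ _ ⟨z', hz', rfl⟩
    exact TransverseIsotropy.invWeilPairing_localization_eq_zero_of_transverse_of_Δ_neg W hΔ (M := 1) le_rfl hℓp hℓ2 hv hgood
      hℓ e hμ hadd₁ hadd₂ halt hgal inv ((h𝒯 z).mp hz) ((h𝒯 z').mp hz')
  obtain ⟨M, hM2, hMX, hXM⟩ := exists_localCondition_two_le_of_isotropic W v e hμ hadd₁ hadd₂ hgal hnondeg inv hinv hV X hXiso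
  refine ⟨M, hM2, fun Z hZ ↦ ⟨fun m hm ↦ hMX _ ⟨Z, (h𝒯 Z).mpr hZ, rfl⟩ m hm, hXM _ ⟨Z, (h𝒯 Z).mpr hZ, rfl⟩⟩⟩

end Rat

end Summit.BirchSwinnertonDyer.BirchSwinnertonDyer.Theorems.KolyvaginLowerTwo

end
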